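import Summits.QuantumFields.BalabanUV.T4Continuum.Support.NE3RightInverseL2Letter
import Summits.QuantumFields.BalabanUV.T4Continuum.Support.NE3SmoothRightInverseW
import Summits.QuantumFields.BalabanUV.T4Continuum.Support.NE3NestedBlockMeanJensen
import Summits.QuantumFields.BalabanUV.T4Continuum.Support.NE3CovariantCompetitorValue
import Summits.QuantumFields.BalabanUV.T4Continuum.Support.NE3CurvedFrameKill
import Summits.QuantumFields.BalabanUV.T4Continuum.Support.NE3CovariantBlockMean
import HarnessLib

/-!
# NE7RightInverseFrameLetters — (Θ): THE ACCUMULATED FRAMES OF ROW NE3's RIGHT INVERSE `R_W` IN ℓ² AND ℓ¹ OVER THE COARSE PERIOD BOX, k-FREE: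
# `Σ_{z∈periodBox N} ‖framePotW L (k+1) W (rightInvW … hφ) z‖² ≤ 2^d·(frameC·liftC)²·#l1Ball(frameRad) ∕ (1 − thetaLoc·(L^{k+1})²x)² · dirSq φ (periodBox N)` and the ℓ¹ twin —
# the «ONE new analytic lemma» (J1) of t4-ne7-p1 g103's remaining bill to row NE7's `hdecomp♭` (memo `t4/b2b-balaban-t4-ne7-p1-g103/ROAD-G103.md` §7), which the frame-free right inverse
# `R₀ φ = R_W φ + gaugeDir W (sfixW (framePotW (R_W φ)))` (`NE7FrameFreeRightInverse`) needs for its ℓ²∕ℓ¹ letters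

Cell `pub-balaban`, rung (B)+1 sub-cell t4, lineage `b2b-balaban-t4-ne7b-p1`, generation 152 (OWNER of BINDER row NE7b; junction service for the NE crew, ruling R-OWNER-149-1 (2)).
THE MECHANISM (exact, then Jensen).  `R_W φ = hatInvW L k W Φ` at the solved coarse datum `Φ = ext((1+K)⁻¹ res φ)`, and `hatInvW Φ = covLift Φ + gaugeDir W λ`, `λ = tinterpW M W (−G)`,
`G = frameGen Φ = framePotW (covLift Φ)` (`NE3CovariantLift`).  By additivity of the accumulated frames (`NE3CurvedFrameKill.framePotW_add`) and the exact curved (‡)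
`framePotW (gaugeDir W λ) z = λ(M•z) − bmeanIterW λ z` (`NE3CovariantBlockMean.framePotW_gaugeDir`) with the corner values of the covariant tent interpolant `λ(M•z) = −G z`
(`tinterpW_corner`): **`framePotW (hatInvW Φ) z = −bmeanIterW L (k+1) W λ z`** — the frame generator cancels EXACTLY at the corners and only the NESTED TRANSPORTED BLOCK MEAN of the
corrector survives.  Jensen for that mean (`NE3NestedBlockMeanJensen.norm_bmeanIterW_le_mean`) and the vertex bound of the tent interpolant on the block of `z`
(`NE3CovariantCompetitorValue.normSq_tinterpW_le`, `blk_boxVec`) give the LOCAL letter `‖framePotW (hatInvW Φ) z‖² ≤ Σ_{T⊆univ} ‖G (z + indic T)‖²`; summing over the period box with the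
shift invariance of periodic sums (`sum_periodBox_shift`) and W6b¹'s locality of `G` (`NE3FrameGenLocal.sum_normSq_frameGen_le` ∕ `sum_norm_frameGen_le`) gives (Θ) at a generic periodic datum,
and the solve letters (`NE3RightInverseSolveLetters.dirSq_solve_le` ∕ `dirL1_solve_le`) give it for `R_W`.  No `(L^{k+1})`-power, no `k`, no `N` in the constants.
WHAT ([folklore]; 0 def, 0 sorry).  §1 `framePotW_hatInvW` (the identity).  §2 `normSq_framePotW_hatInvW_le`, `norm_framePotW_hatInvW_le` (local letters).  §3 `sum_normSq_framePotW_hatInvW_le`,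
`sum_norm_framePotW_hatInvW_le` (generic `N`-periodic skew datum).  §4 **`sum_normSq_framePotW_rightInvW_le`**, **`sum_norm_framePotW_rightInvW_le`** (Θ₂ ∕ Θ₁ for `R_W`).
HONEST FRAMING (page 1): kinematics of OUR objects over landed kernel theorems; nothing of Bałaban's asserted; NOT the `R₀` ℓ-letters themselves ((J1)'s compositions), NOT (J2)∕(J3), NOT NE7,
nothing of row NE7b; spine 0∕9; finite T⁴ rung (B)+1 — NOT infinite volume, NOT mass gap, NOT BetaPertH, NOT Clay.  Continuum YM on T⁴ ⇐ BetaPertH ∧ nine spine estimates (0/9 proved);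
BetaPertH ⇐ (D1) ∧ (D4) ∧ CAP+tail; G-an2-4 gates asym, D1 and NE2/3/4.
-/

set_option autoImplicit false

open scoped BigOperators Matrix.Norms.L2Operator
open Finset

namespace Summit.QuantumFields.BalabanUV.T4Continuum.NE7RightInverseFrameLetters

open Literature.MathematicalPhysics.QuantumFieldTheory.Balaban1983to89
open B7Prop1Explicit B7Prop2Explicit
open T4AveragingDeficitWall (IsUnitaryCfg IsSkewDir SmallField dirSq dirL1)
open T4AveragingDeficitWallBoundary (IsPeriodicCfg periodBox card_periodBox sum_periodBox_shift)
open AveragingDeficitPeriodicCounting (IsPeriodicDir)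
open AveragingDeficitMultiLevelPrep (LevelSmall tower)
open AveragingDeficitTorusChart (TDir extDir isPeriodicDir_extDir)
open BlockAveragePushDirGauge (gaugeDir)
open SmoothRefineBlocks (blk blk_boxVec)
open SmoothRefineInterp (indic)
open NE3CovariantTentInterpolant (tinterpW tinterpW_corner tinterpW_mem_skewAdjoint tinterpW_add_period)
open NE3CovariantCompetitorValue (normSq_tinterpW_le)
open NE3CovariantLift (covLift hatInvW frameGen frameGen_skew frameGen_add_period)
open NE3TangentCovariantTower (framePotW)
open NE3CurvedFrameKill (framePotW_add)
open NE3CovariantBlockMean (bmeanIterW framePotW_gaugeDir)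
open NE3NestedBlockMeanJensen (norm_bmeanIterW_le_mean)
open NE3FramePotBoundW (tower_eq_pow_mul)
open NE3QbarIterCovLiftPrep (liftC cruxC)
open NE3RightInverseSupLetters (frameC)
open NE3RightInverseSolveLetters (l1Ball thetaLoc dirSq_solve_le dirL1_solve_le)
open NE3FrameGenLocal (frameRad sum_normSq_frameGen_le sum_norm_frameGen_le)
open NE3SmoothRightInverseW (rightInvW solveW resSkew isSkewDir_extDir_solveW)
open AveragingDeficitTwoLevelPrep (skewSub)

noncomputable section

variable {d : ℕ} {n : Type*} [Fintype n] [DecidableEq n]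

section Generic

variable [Nonempty n] {L : ℕ} (hL : 2 ≤ L) (k : ℕ) {N : ℕ} [NeZero N] {W : Site d → Fin d → (Matrix n n ℂ)ˣ} {x : ℝ}
  (hWu : IsUnitaryCfg W) (hWP : IsPeriodicCfg W ((tower L N (k + 1) : ℕ) : ℤ)) (hx : 0 ≤ x) (hs : LevelSmall d L k x) (hWx : SmallField W x)
  {Φ : Site d → Fin d → Matrix n n ℂ} (hΦ : IsSkewDir Φ) (hΦP : IsPeriodicDir Φ (N : ℤ))

/-! ## §1 The identity: only the nested mean of the corrector survives -/

include hL hWu hWP hx hs hWx hΦ hΦP in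
/-- **`framePotW L (k+1) W (hatInvW L k W Φ) z = −bmeanIterW L (k+1) W (tinterpW (L^{k+1}) W (−frameGen L k W Φ)) z`** (class at `W` of period `L^{k+1}·N`, skew `N`-periodic `Φ`):
additivity of the accumulated frames, the curved (‡) for the corrector's gauge direction, and the corner values of the tent interpolant cancel the generator exactly. [folklore] -/
theorem framePotW_hatInvW (z : Site d) :
    framePotW L (k + 1) W (hatInvW L k W Φ) z
      = -bmeanIterW L (k + 1) W (tinterpW (L ^ (k + 1)) W (fun w => -frameGen L k W Φ w)) z := by
  have hL1 : 1 ≤ L := by omega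
  have hM1 : 1 ≤ L ^ (k + 1) := Nat.one_le_pow _ _ hL1
  have hT : ((tower L N (k + 1) : ℕ) : ℤ) = (((L ^ (k + 1) : ℕ) : ℤ)) * N := by rw [tower_eq_pow_mul]; push_cast; ring
  have hWP' : IsPeriodicCfg W ((((L ^ (k + 1) : ℕ) : ℤ)) * N) := by rw [← hT]; exact hWP
  -- the generator: skew, periodic
  have hnegGs : ∀ w, (fun w => -frameGen L k W Φ w) w ∈ skewAdjoint (Matrix n n ℂ) := fun w =>
    (skewAdjoint (Matrix n n ℂ)).neg_mem (frameGen_skew hL k hWu hx hs hWx hΦ w)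
  have hnegGP : ∀ (w : Site d) (i : Fin d), (fun w => -frameGen L k W Φ w) (w + (N : ℤ) • e i) = (fun w => -frameGen L k W Φ w) w :=
    fun w i => by simp only [frameGen_add_period hL k hWP hΦP w i]
  -- the corrector's generator: skew, `tower`-periodic, with corner values `−G`
  have hlams : ∀ y, tinterpW (L ^ (k + 1)) W (fun w => -frameGen L k W Φ w) y ∈ skewAdjoint (Matrix n n ℂ) := fun y =>
    tinterpW_mem_skewAdjoint (L ^ (k + 1)) hWu hnegGs y
  have hlamP : ∀ (y : Site d) (i : Fin d), tinterpW (L ^ (k + 1)) W (fun w => -frameGen L k W Φ w) (y + ((tower L N (k + 1) : ℕ) : ℤ) • e i)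
      = tinterpW (L ^ (k + 1)) W (fun w => -frameGen L k W Φ w) y := by
    intro y i
    rw [hT, show (((L ^ (k + 1) : ℕ) : ℤ)) * (N : ℤ) = ((L ^ (k + 1) * N : ℕ) : ℤ) by push_cast; ring]
    exact tinterpW_add_period hM1 hWP' hnegGP y i
  have hcorner : tinterpW (L ^ (k + 1)) W (fun w => -frameGen L k W Φ w) (((L : ℤ) ^ (k + 1)) • z) = -frameGen L k W Φ z := by
    rw [show ((L : ℤ) ^ (k + 1)) = (((L ^ (k + 1) : ℕ) : ℤ)) by push_cast; ring]
    exact tinterpW_corner hM1 W (fun w => -frameGen L k W Φ w) z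
  -- assemble
  have hR : hatInvW L k W Φ = fun y μ => covLift (L ^ (k + 1)) W Φ y μ + gaugeDir W (tinterpW (L ^ (k + 1)) W (fun w => -frameGen L k W Φ w)) y μ := rfl
  have hadd := framePotW_add hL1 k hWu hx hs hWx (covLift (L ^ (k + 1)) W Φ) (gaugeDir W (tinterpW (L ^ (k + 1)) W (fun w => -frameGen L k W Φ w))) z
  rw [hR, hadd, framePotW_gaugeDir (M := N) hL1 k hWu hWP hx hs hWx hlams hlamP z, hcorner]
  show frameGen L k W Φ z + (-frameGen L k W Φ z - _) = _
  abel

/-! ## §2 The local letters at one coarse site -/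

include hL hWu hWP hx hs hWx hΦ hΦP in
/-- **LOCAL ℓ² LETTER**: `‖framePotW L (k+1) W (hatInvW L k W Φ) z‖² ≤ Σ_{T ⊆ univ} ‖frameGen L k W Φ (z + indic T)‖²` — Jensen for the nested transported mean over the block of `z`, on
which the tent interpolant is bounded by its `2^d` vertex data. [folklore] -/
theorem normSq_framePotW_hatInvW_le (z : Site d) :
    ‖framePotW L (k + 1) W (hatInvW L k W Φ) z‖ ^ 2 ≤ ∑ T ∈ (Finset.univ : Finset (Fin d)).powerset, ‖frameGen L k W Φ (z + indic T)‖ ^ 2 := by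
  have hL1 : 1 ≤ L := by omega
  have hM1 : 1 ≤ L ^ (k + 1) := Nat.one_le_pow _ _ hL1
  set S : ℝ := ∑ T ∈ (Finset.univ : Finset (Fin d)).powerset, ‖frameGen L k W Φ (z + indic T)‖ ^ 2 with hSdef
  have hS0 : 0 ≤ S := Finset.sum_nonneg fun _ _ => sq_nonneg _
  set s : ℝ := Real.sqrt S with hsdef
  have hs0 : 0 ≤ s := Real.sqrt_nonneg _
  -- on the block of `z` the corrector's generator is bounded by `s`
  have hlam : ∀ v ∈ periodBox (d := d) (L ^ (k + 1)),
      ‖tinterpW (L ^ (k + 1)) W (fun w => -frameGen L k W Φ w) ((((L ^ (k + 1) : ℕ) : ℤ)) • z + v)‖ ≤ s := by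
    intro v hv
    obtain ⟨r, -, rfl⟩ := Finset.mem_image.mp hv
    have h := normSq_tinterpW_le hM1 hWu (fun w => -frameGen L k W Φ w) ((((L ^ (k + 1) : ℕ) : ℤ)) • z + boxVec (L ^ (k + 1)) r)
    rw [blk_boxVec hM1 z r] at h
    simp only [norm_neg] at h
    calc ‖tinterpW (L ^ (k + 1)) W (fun w => -frameGen L k W Φ w) ((((L ^ (k + 1) : ℕ) : ℤ)) • z + boxVec (L ^ (k + 1)) r)‖
        = Real.sqrt (‖tinterpW (L ^ (k + 1)) W (fun w => -frameGen L k W Φ w) ((((L ^ (k + 1) : ℕ) : ℤ)) • z + boxVec (L ^ (k + 1)) r)‖ ^ 2) :=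
          (Real.sqrt_sq (norm_nonneg _)).symm
      _ ≤ s := Real.sqrt_le_sqrt h
  -- Jensen for the nested mean, and the mean of a constant bound
  have hJ := norm_bmeanIterW_le_mean hL1 k hWu hx hs hWx (tinterpW (L ^ (k + 1)) W (fun w => -frameGen L k W Φ w)) z
  have hMd : (0 : ℝ) < (((L ^ (k + 1) : ℕ) : ℝ)) ^ d := by positivity
  have hsum : ∑ v ∈ periodBox (d := d) (L ^ (k + 1)), ‖tinterpW (L ^ (k + 1)) W (fun w => -frameGen L k W Φ w) ((((L ^ (k + 1) : ℕ) : ℤ)) • z + v)‖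
      ≤ (((L ^ (k + 1) : ℕ) : ℝ)) ^ d * s := by
    have h := Finset.sum_le_sum hlam
    rw [Finset.sum_const, card_periodBox, nsmul_eq_mul] at h
    have e : ((((L ^ (k + 1)) ^ d : ℕ) : ℝ)) = (((L ^ (k + 1) : ℕ) : ℝ)) ^ d := by push_cast; ring
    rw [e] at h
    exact h
  have hmean : ((((L ^ (k + 1) : ℕ) : ℝ)) ^ d)⁻¹ * ∑ v ∈ periodBox (d := d) (L ^ (k + 1)),
      ‖tinterpW (L ^ (k + 1)) W (fun w => -frameGen L k W Φ w) ((((L ^ (k + 1) : ℕ) : ℤ)) • z + v)‖ ≤ s := by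
    calc ((((L ^ (k + 1) : ℕ) : ℝ)) ^ d)⁻¹ * ∑ v ∈ periodBox (d := d) (L ^ (k + 1)),
          ‖tinterpW (L ^ (k + 1)) W (fun w => -frameGen L k W Φ w) ((((L ^ (k + 1) : ℕ) : ℤ)) • z + v)‖
        ≤ ((((L ^ (k + 1) : ℕ) : ℝ)) ^ d)⁻¹ * ((((L ^ (k + 1) : ℕ) : ℝ)) ^ d * s) := mul_le_mul_of_nonneg_left hsum (by positivity)
      _ = s := by field_simp
  rw [framePotW_hatInvW hL k hWu hWP hx hs hWx hΦ hΦP z, norm_neg]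
  calc ‖bmeanIterW L (k + 1) W (tinterpW (L ^ (k + 1)) W (fun w => -frameGen L k W Φ w)) z‖ ^ 2 ≤ s ^ 2 :=
        pow_le_pow_left₀ (norm_nonneg _) (hJ.trans hmean) 2
    _ = S := Real.sq_sqrt hS0

include hL hWu hWP hx hs hWx hΦ hΦP in
/-- **LOCAL ℓ¹ LETTER**: `‖framePotW L (k+1) W (hatInvW L k W Φ) z‖ ≤ Σ_{T ⊆ univ} ‖frameGen L k W Φ (z + indic T)‖`. [folklore] -/
theorem norm_framePotW_hatInvW_le (z : Site d) :
    ‖framePotW L (k + 1) W (hatInvW L k W Φ) z‖ ≤ ∑ T ∈ (Finset.univ : Finset (Fin d)).powerset, ‖frameGen L k W Φ (z + indic T)‖ := by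
  have h := (normSq_framePotW_hatInvW_le hL k hWu hWP hx hs hWx hΦ hΦP z).trans
    (Finset.sum_sq_le_sq_sum_of_nonneg fun T _ => norm_nonneg (frameGen L k W Φ (z + indic T)))
  exact (pow_le_pow_iff_left₀ (norm_nonneg _) (Finset.sum_nonneg fun _ _ => norm_nonneg _) two_ne_zero).mp h

/-! ## §3 (Θ) at a generic skew `N`-periodic coarse datum -/

include hL hWu hWP hx hs hWx hΦ hΦP in
/-- **(Θ₂) FOR `hatInvW`**: `Σ_{z∈periodBox N} ‖framePotW L (k+1) W (hatInvW L k W Φ) z‖² ≤ 2^d·(frameC·liftC)²·#l1Ball(frameRad)·dirSq Φ (periodBox N)`. [folklore] -/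
theorem sum_normSq_framePotW_hatInvW_le :
    ∑ z ∈ periodBox (d := d) N, ‖framePotW L (k + 1) W (hatInvW L k W Φ) z‖ ^ 2
      ≤ (2 : ℝ) ^ d * ((frameC d L * liftC d) ^ 2 * ((l1Ball (frameRad d L) : Finset (Site d))).card * dirSq Φ (periodBox (d := d) N)) := by
  have hN : 1 ≤ N := Nat.one_le_iff_ne_zero.mpr (NeZero.ne N)
  have h1 : ∑ z ∈ periodBox (d := d) N, ‖framePotW L (k + 1) W (hatInvW L k W Φ) z‖ ^ 2
      ≤ ∑ z ∈ periodBox (d := d) N, ∑ T ∈ (Finset.univ : Finset (Fin d)).powerset, ‖frameGen L k W Φ (z + indic T)‖ ^ 2 :=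
    Finset.sum_le_sum fun z _ => normSq_framePotW_hatInvW_le hL k hWu hWP hx hs hWx hΦ hΦP z
  rw [Finset.sum_comm] at h1
  have hper : ∀ (z : Site d) (κ : Fin d), ‖frameGen L k W Φ (z + (N : ℤ) • e κ)‖ ^ 2 = ‖frameGen L k W Φ z‖ ^ 2 := fun z κ => by
    rw [frameGen_add_period hL k hWP hΦP z κ]
  have hshift : ∀ T ∈ (Finset.univ : Finset (Fin d)).powerset,
      ∑ z ∈ periodBox (d := d) N, ‖frameGen L k W Φ (z + indic T)‖ ^ 2 = ∑ z ∈ periodBox (d := d) N, ‖frameGen L k W Φ z‖ ^ 2 :=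
    fun T _ => by
      have h := sum_periodBox_shift N hN (g := fun w => ‖frameGen L k W Φ w‖ ^ 2) hper (indic T)
      simpa only using h
  rw [Finset.sum_congr rfl hshift, Finset.sum_const, Finset.card_powerset, Finset.card_univ, Fintype.card_fin, nsmul_eq_mul] at h1
  push_cast at h1
  have hG := sum_normSq_frameGen_le hL k hWu hx hs hWx hN hΦP
  exact h1.trans (mul_le_mul_of_nonneg_left hG (by positivity))

include hL hWu hWP hx hs hWx hΦ hΦP in
/-- **(Θ₁) FOR `hatInvW`**: `Σ_{z∈periodBox N} ‖framePotW L (k+1) W (hatInvW L k W Φ) z‖ ≤ 2^d·frameC·liftC·#l1Ball(frameRad)·dirL1 Φ (periodBox N)`. [folklore] -/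
theorem sum_norm_framePotW_hatInvW_le :
    ∑ z ∈ periodBox (d := d) N, ‖framePotW L (k + 1) W (hatInvW L k W Φ) z‖
      ≤ (2 : ℝ) ^ d * (frameC d L * liftC d * ((l1Ball (frameRad d L) : Finset (Site d))).card * dirL1 Φ (periodBox (d := d) N)) := by
  have hN : 1 ≤ N := Nat.one_le_iff_ne_zero.mpr (NeZero.ne N)
  have h1 : ∑ z ∈ periodBox (d := d) N, ‖framePotW L (k + 1) W (hatInvW L k W Φ) z‖
      ≤ ∑ z ∈ periodBox (d := d) N, ∑ T ∈ (Finset.univ : Finset (Fin d)).powerset, ‖frameGen L k W Φ (z + indic T)‖ :=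
    Finset.sum_le_sum fun z _ => norm_framePotW_hatInvW_le hL k hWu hWP hx hs hWx hΦ hΦP z
  rw [Finset.sum_comm] at h1
  have hper : ∀ (z : Site d) (κ : Fin d), ‖frameGen L k W Φ (z + (N : ℤ) • e κ)‖ = ‖frameGen L k W Φ z‖ := fun z κ => by
    rw [frameGen_add_period hL k hWP hΦP z κ]
  have hshift : ∀ T ∈ (Finset.univ : Finset (Fin d)).powerset,
      ∑ z ∈ periodBox (d := d) N, ‖frameGen L k W Φ (z + indic T)‖ = ∑ z ∈ periodBox (d := d) N, ‖frameGen L k W Φ z‖ :=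
    fun T _ => by
      have h := sum_periodBox_shift N hN (g := fun w => ‖frameGen L k W Φ w‖) hper (indic T)
      simpa only using h
  rw [Finset.sum_congr rfl hshift, Finset.sum_const, Finset.card_powerset, Finset.card_univ, Fintype.card_fin, nsmul_eq_mul] at h1
  push_cast at h1
  have hG := sum_norm_frameGen_le hL k hWu hx hs hWx hN hΦP
  exact h1.trans (mul_le_mul_of_nonneg_left hG (by positivity))

end Generic

/-! ## §4 (Θ) for the exact right inverse `R_W φ = hatInvW (ext((1+K)⁻¹ res φ))` -/

section Solved

variable [Nonempty n] {L : ℕ} (hL : 2 ≤ L) (k : ℕ) {W : Site d → Fin d → (Matrix n n ℂ)ˣ} {x : ℝ} (hWu : IsUnitaryCfg W) (hx : 0 ≤ x) (hs : LevelSmall d L k x)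
  (hWx : SmallField W x) (N : ℕ) [NeZero N] (hθ : cruxC d L * (((L : ℝ) ^ (k + 1)) ^ 2 * x) < 1) (hθl : thetaLoc d L * (((L : ℝ) ^ (k + 1)) ^ 2 * x) < 1)
  (hWP : IsPeriodicCfg W ((tower L N (k + 1) : ℕ) : ℤ)) {φ : Site d → Fin d → Matrix n n ℂ} (hφ : IsSkewDir φ)

include hWP hθl in
/-- **(Θ₂)**: `Σ_{z∈periodBox N} ‖framePotW L (k+1) W (rightInvW … hθ hφ) z‖² ≤ 2^d·(frameC·liftC)²·#l1Ball(frameRad) ∕ (1 − thetaLoc·(L^{k+1})²x)² · dirSq φ (periodBox N)` — k-free, N-free;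
the datum `φ` need not be periodic (only its period-box ℓ² enters). [folklore] -/
theorem sum_normSq_framePotW_rightInvW_le :
    ∑ z ∈ periodBox (d := d) N, ‖framePotW L (k + 1) W (rightInvW hL k hWu hx hs hWx N hθ hφ) z‖ ^ 2
      ≤ (2 : ℝ) ^ d * ((frameC d L * liftC d) ^ 2 * ((l1Ball (frameRad d L) : Finset (Site d))).card)
          / (1 - thetaLoc d L * (((L : ℝ) ^ (k + 1)) ^ 2 * x)) ^ 2 * dirSq φ (periodBox (d := d) N) := by
  have hΦ := isSkewDir_extDir_solveW hL k hWu hx hs hWx N hθ (resSkew N hφ)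
  have hΦP := isPeriodicDir_extDir N ((solveW hL k hWu hx hs hWx N hθ (resSkew N hφ) : ↥(skewSub d n N)) : TDir d n N)
  have h1 := sum_normSq_framePotW_hatInvW_le hL k hWu hWP hx hs hWx hΦ hΦP
  have h2 := dirSq_solve_le hL k hWu hx hs hWx N hθ hθl hφ
  have h1θ : 0 < 1 - thetaLoc d L * (((L : ℝ) ^ (k + 1)) ^ 2 * x) := by linarith
  have hC : 0 ≤ (2 : ℝ) ^ d * ((frameC d L * liftC d) ^ 2 * ((l1Ball (frameRad d L) : Finset (Site d))).card) := by positivity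
  calc ∑ z ∈ periodBox (d := d) N, ‖framePotW L (k + 1) W (rightInvW hL k hWu hx hs hWx N hθ hφ) z‖ ^ 2
      ≤ (2 : ℝ) ^ d * ((frameC d L * liftC d) ^ 2 * ((l1Ball (frameRad d L) : Finset (Site d))).card
          * dirSq (extDir N ((solveW hL k hWu hx hs hWx N hθ (resSkew N hφ) : ↥(skewSub d n N)) : TDir d n N)) (periodBox (d := d) N)) := h1
    _ ≤ (2 : ℝ) ^ d * ((frameC d L * liftC d) ^ 2 * ((l1Ball (frameRad d L) : Finset (Site d))).card
          * (dirSq φ (periodBox (d := d) N) / (1 - thetaLoc d L * (((L : ℝ) ^ (k + 1)) ^ 2 * x)) ^ 2)) := by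
        gcongr
    _ = _ := by field_simp

include hWP hθl in
/-- **(Θ₁)**: `Σ_{z∈periodBox N} ‖framePotW L (k+1) W (rightInvW … hθ hφ) z‖ ≤ 2^d·frameC·liftC·#l1Ball(frameRad) ∕ (1 − thetaLoc·(L^{k+1})²x) · dirL1 φ (periodBox N)` — k-free,
N-free. [folklore] -/
theorem sum_norm_framePotW_rightInvW_le :
    ∑ z ∈ periodBox (d := d) N, ‖framePotW L (k + 1) W (rightInvW hL k hWu hx hs hWx N hθ hφ) z‖
      ≤ (2 : ℝ) ^ d * (frameC d L * liftC d * ((l1Ball (frameRad d L) : Finset (Site d))).card)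
          / (1 - thetaLoc d L * (((L : ℝ) ^ (k + 1)) ^ 2 * x)) * dirL1 φ (periodBox (d := d) N) := by
  have hΦ := isSkewDir_extDir_solveW hL k hWu hx hs hWx N hθ (resSkew N hφ)
  have hΦP := isPeriodicDir_extDir N ((solveW hL k hWu hx hs hWx N hθ (resSkew N hφ) : ↥(skewSub d n N)) : TDir d n N)
  have h1 := sum_norm_framePotW_hatInvW_le hL k hWu hWP hx hs hWx hΦ hΦP
  have h2 := dirL1_solve_le hL k hWu hx hs hWx N hθ hθl hφ
  have h1θ : 0 < 1 - thetaLoc d L * (((L : ℝ) ^ (k + 1)) ^ 2 * x) := by linarith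
  have hC : 0 ≤ (2 : ℝ) ^ d * (frameC d L * liftC d * ((l1Ball (frameRad d L) : Finset (Site d))).card) := by
    have := NE3QbarIterCovLiftPrep.liftC_nonneg d; unfold frameC; positivity
  calc ∑ z ∈ periodBox (d := d) N, ‖framePotW L (k + 1) W (rightInvW hL k hWu hx hs hWx N hθ hφ) z‖
      ≤ (2 : ℝ) ^ d * (frameC d L * liftC d * ((l1Ball (frameRad d L) : Finset (Site d))).card
          * dirL1 (extDir N ((solveW hL k hWu hx hs hWx N hθ (resSkew N hφ) : ↥(skewSub d n N)) : TDir d n N)) (periodBox (d := d) N)) := h1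
    _ ≤ (2 : ℝ) ^ d * (frameC d L * liftC d * ((l1Ball (frameRad d L) : Finset (Site d))).card
          * (dirL1 φ (periodBox (d := d) N) / (1 - thetaLoc d L * (((L : ℝ) ^ (k + 1)) ^ 2 * x)))) := by
        have hfl : 0 ≤ frameC d L * liftC d * ((l1Ball (frameRad d L) : Finset (Site d))).card := by
          have := NE3QbarIterCovLiftPrep.liftC_nonneg d; unfold frameC; positivity
        exact mul_le_mul_of_nonneg_left (mul_le_mul_of_nonneg_left h2 hfl) (by positivity)
    _ = _ := by field_simp

end Solved

end

end Summit.QuantumFields.BalabanUV.T4Continuum.NE7RightInverseFrameLetters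

/-! ## §5 (v2 APPEND) Nonnegativity of the two (Θ) constants — the `0 ≤ CΘ₂`, `0 ≤ CΘ₁` slots of t4-ne7-p1 g104's `NE7FrameFreeRightInverseLetters` (R1⁰)–(R3⁰) instantiation -/

namespace Summit.QuantumFields.BalabanUV.T4Continuum.NE7RightInverseFrameLetters

open Literature.MathematicalPhysics.QuantumFieldTheory.Balaban1983to89
open B7Prop1Explicit
open NE3QbarIterCovLiftPrep (liftC liftC_nonneg)
open NE3RightInverseSupLetters (frameC)
open NE3RightInverseSolveLetters (l1Ball thetaLoc)
open NE3FrameGenLocal (frameRad)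

/-- `0 ≤ CΘ₂ = 2^d·((frameC·liftC)²·#l1Ball(frameRad))`. [folklore] -/
theorem thetaTwoConst_nonneg (d L : ℕ) :
    0 ≤ (2 : ℝ) ^ d * ((frameC d L * liftC d) ^ 2 * ((l1Ball (frameRad d L) : Finset (Site d))).card) := by
  positivity

/-- `0 ≤ CΘ₁ = 2^d·(frameC·liftC·#l1Ball(frameRad))`. [folklore] -/
theorem thetaOneConst_nonneg (d L : ℕ) :
    0 ≤ (2 : ℝ) ^ d * (frameC d L * liftC d * ((l1Ball (frameRad d L) : Finset (Site d))).card) := by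
  unfold frameC; have := liftC_nonneg d; positivity

/-- `0 ≤ CΘ₂ ∕ (1 − thetaLoc·(L^{k+1})²x)²` (the solved (Θ₂) coefficient). [folklore] -/
theorem thetaTwoCoeff_nonneg (d L k : ℕ) (x : ℝ) :
    0 ≤ (2 : ℝ) ^ d * ((frameC d L * liftC d) ^ 2 * ((l1Ball (frameRad d L) : Finset (Site d))).card)
      / (1 - thetaLoc d L * (((L : ℝ) ^ (k + 1)) ^ 2 * x)) ^ 2 :=
  div_nonneg (thetaTwoConst_nonneg d L) (sq_nonneg _)

/-- `0 ≤ CΘ₁ ∕ (1 − thetaLoc·(L^{k+1})²x)` under `thetaLoc·(L^{k+1})²x < 1` (the solved (Θ₁) coefficient). [folklore] -/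
theorem thetaOneCoeff_nonneg (d L k : ℕ) {x : ℝ} (hθl : thetaLoc d L * (((L : ℝ) ^ (k + 1)) ^ 2 * x) < 1) :
    0 ≤ (2 : ℝ) ^ d * (frameC d L * liftC d * ((l1Ball (frameRad d L) : Finset (Site d))).card)
      / (1 - thetaLoc d L * (((L : ℝ) ^ (k + 1)) ^ 2 * x)) :=
  div_nonneg (thetaOneConst_nonneg d L) (by linarith)

end Summit.QuantumFields.BalabanUV.T4Continuum.NE7RightInverseFrameLetters
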